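import Mathlib
import Summits.Ventures.HodgeRepro2.T5CyclotomicSubfieldSatake
import Summits.Ventures.HodgeRepro2.T5CMConjugation

/-!
# EVERY CM SUBFIELD OF `ℚ(ζₘ)` HAS INFINITELY MANY DEGREE-ONE INERT PLACES AND INFINITELY MANY SPLIT PLACES

Tier-5 support N3 / §G-N4.2 (seat p3, gen 81). For a CM subfield `F ⊆ ℚ(ζₘ)` of any degree (file 293's criterion:
a place of `F⁺` above `p ∤ m` stays prime in `F` iff `(−1) · H_F ∈ ⟨p · H_F⟩`):

* `neg_one_notMem_zmodSubgroup`: `−1 ∉ H_F` — complex conjugation is not trivial on a CM field (file 292's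
  `restrictNormal_conjGal` + Mathlib's `complexConj_ne_one`);
* **`exists_map_eq_of_eq_neg_one_mod`**: for every prime `p ≡ −1 mod m`, every place of `F⁺` above `p` STAYS PRIME in
  `F` with `f(𝔭/p) = 2` and `f(v/p) = 1` (a degree-one inert place, `N(v) = p`);
* **`inertiaDeg_eq_one_of_eq_one_mod`**: for every prime `p ≡ 1 mod m`, `p` splits completely in `F`, in particular
  every place of `F⁺` above `p` has TWO primes of `F` above it;
* `infinite_setOf_prime_eq_neg_one_mod`, `infinite_setOf_prime_eq_one_mod` (Dirichlet, Mathlib): both classes are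
  infinite — so the inert regime of the record's Satake chain (file 295) is inhabited at infinitely many degree-one
  places of every abelian CM field presented inside a cyclotomic field, and so is the split regime;
* `mem_zpowers_iff_even_orderOf_of_isCyclic`: when `Gal(F/ℚ)` is cyclic, file 293's membership criterion is file 281's
  parity criterion (`(−1) · H_F ∈ ⟨p · H_F⟩ ⟺ ord(p · H_F)` even) — the bridge to files 287 / 290.

§8(d): uses an L-value-free non-vanishing device: NO.
-/

open NumberField NumberField.IsCMField IsCyclotomicExtension.Rat Ideal IsDedekindDomain
  IsDedekindDomain.HeightOneSpectrum
open Summit.Ventures.HodgeRepro2.T5CMTypeGaloisDialect Summit.Ventures.HodgeRepro2.T5CyclotomicSubfieldInertiaDeg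
  Summit.Ventures.HodgeRepro2.T5CyclotomicConjugation Summit.Ventures.HodgeRepro2.T5CyclotomicSubfieldDecomposition
  Summit.Ventures.HodgeRepro2.T5CyclotomicSubfieldSatake

namespace Summit.Ventures.HodgeRepro2.T5CyclotomicSubfieldInfinitude

variable (m : ℕ) [NeZero m] (L : Type*) [Field L] [NumberField L] [IsCyclotomicExtension {m} ℚ L] [IsCMField L]
  (F : IntermediateField ℚ L) [IsCMField F]

/-- **`−1 ∉ H_F` for a CM subfield `F`**: the conjugation of `ℚ(ζₘ)` (`= −1`) restricts to the conjugation of `F`,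
which is not the identity. -/
theorem neg_one_notMem_zmodSubgroup : (-1 : (ZMod m)ˣ) ∉ zmodSubgroup m L F := by
  haveI : IsGalois ℚ F := T5CyclotomicUnramified.isGalois_intermediateField L m F
  rw [mem_zmodSubgroup_iff, ← galEquivZMod_conjGal m L, MulEquiv.symm_apply_apply,
    IntermediateField.mem_fixingSubgroup_iff]
  intro h
  apply T5CMConjugation.conjGal_ne_one F
  rw [← restrictNormal_conjGal L F]
  ext x
  show algebraMap F L ((conjGal L).restrictNormal F x) = algebraMap F L x
  rw [AlgEquiv.restrictNormal_commutes]
  exact h x x.2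

variable (p : ℕ) [hp : Fact p.Prime] (hpm : p.Coprime m)
  (𝔭 : Ideal (𝓞 F)) [h𝔭 : 𝔭.IsPrime] [h𝔭p : 𝔭.LiesOver (span {(p : ℤ)})]
  (v : HeightOneSpectrum (𝓞 (maximalRealSubfield F))) [hPv : 𝔭.LiesOver v.asIdeal]

omit [NeZero m] hp in
/-- `p ≡ −1 mod m` ⟹ `p mod m = −1` in `(ℤ/mℤ)ˣ`. -/
theorem unitOfCoprime_eq_neg_one (h : (p : ZMod m) = -1) : ZMod.unitOfCoprime p hpm = -1 := by
  rw [Units.ext_iff, ZMod.coe_unitOfCoprime, h, Units.val_neg, Units.val_one]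

include hpm h𝔭 h𝔭p hPv in
/-- **EVERY PRIME `p ≡ −1 mod m` GIVES DEGREE-ONE INERT PLACES OF EVERY CM SUBFIELD `F ⊆ ℚ(ζₘ)`**: `f(𝔭/p) = 2`,
`f(v/p) = 1`, and the place `v` of `F⁺` under `𝔭` stays prime in `F`. -/
theorem exists_map_eq_of_eq_neg_one_mod (h : (p : ZMod m) = -1) :
    𝔭.inertiaDeg ℤ = 2 ∧ v.asIdeal.inertiaDeg ℤ = 1 ∧
      ∃ w : HeightOneSpectrum (𝓞 F),
        Ideal.map (algebraMap (𝓞 (maximalRealSubfield F)) (𝓞 F)) v.asIdeal = w.asIdeal := by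
  have hu : ZMod.unitOfCoprime p hpm = -1 := unitOfCoprime_eq_neg_one m p hpm h
  have hmem : (QuotientGroup.mk (-1) : (ZMod m)ˣ ⧸ zmodSubgroup m L F) ∈
      Subgroup.zpowers (QuotientGroup.mk (ZMod.unitOfCoprime p hpm)) := by
    rw [hu]
    exact Subgroup.mem_zpowers _
  have hord : orderOf (QuotientGroup.mk (ZMod.unitOfCoprime p hpm) : (ZMod m)ˣ ⧸ zmodSubgroup m L F) = 2 := by
    rw [hu]
    apply orderOf_eq_prime
    · rw [← QuotientGroup.mk_pow, neg_one_sq, QuotientGroup.mk_one]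
    · intro h1
      rw [QuotientGroup.eq_one_iff] at h1
      exact neg_one_notMem_zmodSubgroup m L F h1
  have h2 := two_mul_inertiaDeg_eq_orderOf_mk m L F p hpm 𝔭 v hmem
  rw [hord] at h2
  refine ⟨?_, by omega, (exists_map_eq_iff_mem_zpowers m L F p hpm 𝔭 v).mpr hmem⟩
  rw [inertiaDeg_eq_orderOf_mk m L F p hpm 𝔭, hord]

include hpm h𝔭 h𝔭p hPv in
/-- **EVERY PRIME `p ≡ 1 mod m` SPLITS COMPLETELY IN `F`**: `f(𝔭/p) = 1` and the place of `F⁺` under `𝔭` has two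
primes of `F` above it. -/
theorem inertiaDeg_eq_one_of_eq_one_mod (h : (p : ZMod m) = 1) :
    𝔭.inertiaDeg ℤ = 1 ∧ (v.asIdeal.primesOver (𝓞 F)).ncard = 2 := by
  have hu : ZMod.unitOfCoprime p hpm = 1 := by
    rw [Units.ext_iff, ZMod.coe_unitOfCoprime, h, Units.val_one]
  refine ⟨?_, ?_⟩
  · rw [inertiaDeg_eq_orderOf_mk m L F p hpm 𝔭, hu, QuotientGroup.mk_one, orderOf_one]
  · rw [ncard_primesOver_eq_two_iff_notMem m L F p hpm 𝔭 v, hu, QuotientGroup.mk_one,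
      Subgroup.zpowers_one_eq_bot, Subgroup.mem_bot, QuotientGroup.eq_one_iff]
    exact neg_one_notMem_zmodSubgroup m L F

omit [IsCMField L] in
/-- **Dirichlet**: infinitely many primes `p ≡ −1 mod m` (Mathlib's `Nat.infinite_setOf_prime_and_eq_mod`). -/
theorem infinite_setOf_prime_eq_neg_one_mod : {p : ℕ | p.Prime ∧ (p : ZMod m) = -1}.Infinite :=
  Nat.infinite_setOf_prime_and_eq_mod isUnit_one.neg

omit [IsCMField L] in
/-- **Dirichlet**: infinitely many primes `p ≡ 1 mod m`. -/
theorem infinite_setOf_prime_eq_one_mod : {p : ℕ | p.Prime ∧ (p : ZMod m) = 1}.Infinite :=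
  Nat.infinite_setOf_prime_and_eq_mod isUnit_one

include hpm h𝔭 h𝔭p hPv in
/-- **THE CYCLIC CASE**: when `Gal(F/ℚ)` is cyclic, file 293's membership criterion IS file 281's parity criterion —
`(−1) · H_F ∈ ⟨p · H_F⟩ ⟺ ord(p · H_F)` is even. -/
theorem mem_zpowers_iff_even_orderOf_of_isCyclic [IsCyclic (F ≃ₐ[ℚ] F)] :
    (QuotientGroup.mk (-1) : (ZMod m)ˣ ⧸ zmodSubgroup m L F) ∈
        Subgroup.zpowers (QuotientGroup.mk (ZMod.unitOfCoprime p hpm)) ↔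
      Even (orderOf (QuotientGroup.mk (ZMod.unitOfCoprime p hpm) : (ZMod m)ˣ ⧸ zmodSubgroup m L F)) := by
  haveI : IsGalois ℚ F := T5CyclotomicUnramified.isGalois_intermediateField L m F
  have he : 𝔭.ramificationIdx ℤ = 1 :=
    T5CyclotomicUnramified.ramificationIdx_eq_one p L F ((Nat.Prime.coprime_iff_not_dvd hp.out).mp hpm) 𝔭
  rw [← ncard_primesOver_eq_one_iff_mem_zpowers' m L F p hpm 𝔭 v, ← inertiaDeg_eq_orderOf_mk m L F p hpm 𝔭]
  exact T5CMFieldCyclicGaloisCriterion.ncard_primesOver_eq_one_iff_even_inertiaDeg F p 𝔭 v he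

end Summit.Ventures.HodgeRepro2.T5CyclotomicSubfieldInfinitude
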